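import Summits.QuantumFields.YangMills.Theorems.BalabanUVNodesN12TowerForest
import HarnessLib

/-!
# BalabanUVNodes ∕ N12 — THE FOREST IN WORD CURRENCY (dag-n12-w6's ASK-4 for the (q2) same-root ∕ non-abelian Stokes bookkeeping): every path of a rooted forest is the lattice WALK of its own
# letter word from a root — `path x = walk (root x) (word x)`, `walkEnd (root x) (word x) = x`, `root x ∈ R`, `|word x| = |path x|` — and, when no step of the path crosses the seam
# (automatic for the tower-confined forest: every step stays inside one block), its net displacement is the TRUE integer displacement `netDisp (word x) ν = x̃_ν − root̃_ν` of the
# labels; at the record's `𝐁_k(Z)`: the tower forest with roots, words, tower confinement, true displacements and the length bound `Σ_{i ≤ j}(d·(L^i − 1)∕2 + 1)`, all BY NAME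

Cell `pub-ymgap` (HUMAN RULINGS D-0062 ∕ D-0149), WIDTH SEAT `pub-ymgap-dag-n12-w3` g3 (node N12 = [B15]; key K1⁹ `stmt-QuantumFields-27364` (KEY MAP v2), `--kind proof --supports … --as helper`;
count-neutral).  THEOREMS ONLY (0 `def`, 0 `instance`, 0 `sorry`); consumed BY NAME: this seat's `N12TowerForest.exists_towerForest` ∕ `exists_towerForest_Bj`,
`N12FlatHndHarmonicLetter.not_wrap_of_iterBlockOf_shift_eq` (p612004), `N12FlatHndRecordLetters.hcov_Bj`; `T4Continuum.walk` ∕ `walkEnd` ∕ `netDisp` ∕ `walk_append` ∕ `netDisp_append`,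
`B6QGQTestBumpsKLevelV1.val_shift_self'`, `Site.unshift_shift` ∕ `shift_unshift`.

WHY.  dag-n12-w6 g1's `T4ForestGaugeSameRootBound.dist1_gaugeAct_holAtGauge_le_of_sameRoot` (the same-root half of the interior letter [15] (16)–(18) ∕ [6] (1.19) via ym3-torus-p2's located
Stokes bound) reads the forest gauge `σ x := 𝒰_U(path x)` with `path s = walk r w₋`, `path (s + e_μ) = walk r w₊`, `netDisp w₊ = netDisp w₋ + e_μ`; its ASK-4 to this seat: «per site the
WORD `w x` with `path x = walk (root x) (w x)`, its TRUE integer displacement (no wrap), and `|w x| ≤ ℓ_j`».  This file supplies exactly that for any rooted forest in the `path` currency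
((F2)+(TREE)): the word is canonical — the letters `(s.bond.dir, s.fwd)` of the steps — the root is the start of the walk; the true-displacement identity holds whenever no step crosses the
seam of its direction, which the tower-confined forest of `N12TowerForest` guarantees (a unit step inside one block never wraps, `not_wrap_of_iterBlockOf_shift_eq`).

CONTENTS.  §1 `walk_singleton_of_step` (one oriented step is the walk of its letter), ★★ `exists_root_walk_word` ((F2)+(TREE) ⟹ `∃ root`, `root x ∈ R` ∧ `path x = walk (root x) (word x)` ∧
`walkEnd (root x) (word x) = x`, `word x := (path x).map (s ↦ (s.bond.dir, s.fwd))`; `root r = r` on `R`).  §2 `val_tgt_eq_of_not_wrap` (labels across a non-wrapping bond), ★★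
`netDisp_word_eq_sub_of_forall_not_wrap` (TRUE INTEGER DISPLACEMENT: if no step of `path x` wraps then `netDisp (word x) ν = (x ν).val − (root x ν).val` in `ℤ`).  `iterBlockOf_root_eq_of_confined` (the root lies in every block confining the path).  §3 ★★★
`exists_towerForest_words` (any `𝐁` under (Cov), `k ≤ m + K`: the tower forest of `N12TowerForest` WITH `root`, words, walks, tower confinement, true displacements for every root level of
the site, and the length bound, the root's block), ★★★ `exists_towerForest_words_Bj` (the record, every `Z`; member form + the (Cov) witness per site), ★★ `root_eq_centre_of_uniqueRoot`
(same root in a singly-rooted block).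

HONEST FRAMING.  Word bookkeeping and label arithmetic; no analysis; nothing of Bałaban's asserted; N12 NOT discharged; K1⁹ NOT closed; counts unmoved (typed 28∕28 · discharged 5∕27);
one finite 𝕋⁴ programme at fixed ε — R4 closes the conditional rung `BalabanLadder.UV` only; the Yang–Mills mass gap (Clay) is NOT proved by any of this; nothing continuum ∕ ℝ⁴ ∕ OS.
-/

noncomputable section

namespace Summit.QuantumFields.YangMills.BalabanUVNodes.N12TowerForestWords

open scoped BigOperators
open Literature.MathematicalPhysics.QuantumFieldTheory.Balaban1983to89
open T4Continuum
open B15DeterminingSets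
open B5Eq118OneStroke (iterBlockOf)
open B6QGQTestBumpsKLevelV1 (val_shift_self')
open Summit.QuantumFields.YangMills.BalabanUVNodes.N12FlatHndHarmonicLetter (not_wrap_of_iterBlockOf_shift_eq)
open Summit.QuantumFields.YangMills.BalabanUVNodes.N12TowerForest (exists_towerForest)

variable {P : Params} {j : ℕ}

/-! ## §1 Every path is the walk of its letter word from a root; the true integer displacement -/

section Words

/-- One oriented step from `x′` to `x` is the one-letter walk of its letter from `x′`. [folklore] -/
theorem walk_singleton_of_step {x' x : Site P j} {s : LStep P j}
    (hor : (s.fwd = true → s.bond.src = x' ∧ s.bond.tgt = x) ∧ (s.fwd = false → s.bond.src = x ∧ s.bond.tgt = x')) :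
    walk x' [(s.bond.dir, s.fwd)] = [s] ∧ walkEnd x' [(s.bond.dir, s.fwd)] = x := by
  obtain ⟨⟨src, dir⟩, fwd⟩ := s
  cases fwd
  · obtain ⟨hs, ht⟩ := hor.2 rfl
    simp only at hs ht
    have hx' : x'.unshift dir = src := by rw [← ht]; exact Site.unshift_shift src dir
    refine ⟨?_, ?_⟩
    · show [(⟨⟨x'.unshift dir, dir⟩, false⟩ : LStep P j)] = _
      rw [hx']
    · show x'.unshift dir = x
      rw [hx', hs]
  · obtain ⟨hs, ht⟩ := hor.1 rfl
    simp only at hs ht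
    refine ⟨?_, ?_⟩
    · show [(⟨⟨x', dir⟩, true⟩ : LStep P j)] = _
      rw [hs]
    · show x'.shift dir = x
      rw [← hs]
      exact ht

/-- Labels across a NON-WRAPPING fine bond `⟨y, μ⟩`: `(y + e_μ)_μ = y_μ + 1` and the other labels agree. [cite: Balaban1987RG1, (0.1) p.251 (bookkeeping)] -/
theorem val_tgt_eq_of_not_wrap (b : PBond P 0) (hb : (b.src b.dir).val + 1 ≠ P.sitesPerDir 0) (ν : Fin P.d) :
    ((b.tgt ν).val : ℤ) = ((b.src ν).val : ℤ) + (if b.dir = ν then 1 else 0) := by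
  by_cases h : b.dir = ν
  · subst h
    have hlt : (b.src b.dir).val + 1 < P.sitesPerDir 0 := lt_of_le_of_ne (ZMod.val_lt _) hb
    rw [if_pos rfl, PBond.tgt, val_shift_self', Nat.mod_eq_of_lt hlt]
    push_cast
    ring
  · rw [if_neg h, PBond.tgt]
    simp only [Site.shift, Function.update_of_ne (Ne.symm h), add_zero]

/-- The net displacement of a one-letter word. [folklore] -/
theorem netDisp_singleton (l : Letter P.d) (ν : Fin P.d) : netDisp [l] ν = if l.1 = ν then (if l.2 then (1 : ℤ) else -1) else 0 := by
  simp [netDisp]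

/-- ★★ **EVERY PATH IS THE WALK OF ITS LETTER WORD FROM A ROOT, WITH ITS TRUE INTEGER DISPLACEMENT**: for a rooted forest of the fine torus with (F2) and (TREE) there is a root map
`root : T → R` (`root r = r` on `R`) such that for every site `x`: `path x = walk (root x) (word x)` and `walkEnd (root x) (word x) = x`, where `word x` is the list of letters
`(s.bond.dir, s.fwd)` of the steps of `path x` (so `|word x| = |path x|`); and IF no step of `path x` crosses the seam of its direction, the net displacement of `word x` is the INTEGER
label difference `netDisp (word x) ν = (x ν).val − (root x ν).val` (no wrap). [cite: Balaban1985RegularSpaces, (1.19) p.79 (the tree; bookkeeping); Balaban1987RG1, (0.1) p.251] -/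
theorem exists_root_walk_word {R : Set (Site P 0)} {path : Site P 0 → List (LStep P 0)} (hroot : ∀ r ∈ R, path r = [])
    (htree : ∀ x, x ∉ R → ∃ (x' : Site P 0) (s : LStep P 0), path x = path x' ++ [s] ∧
      (s.fwd = true → s.bond.src = x' ∧ s.bond.tgt = x) ∧ (s.fwd = false → s.bond.src = x ∧ s.bond.tgt = x')) :
    ∃ root : Site P 0 → Site P 0, (∀ r ∈ R, root r = r) ∧ ∀ x, root x ∈ R ∧
      path x = walk (root x) ((path x).map fun s => (s.bond.dir, s.fwd)) ∧ walkEnd (root x) ((path x).map fun s => (s.bond.dir, s.fwd)) = x ∧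
      ((∀ s ∈ path x, (s.bond.src s.bond.dir).val + 1 ≠ P.sitesPerDir 0) →
        ∀ ν, netDisp ((path x).map fun s => (s.bond.dir, s.fwd)) ν = ((x ν).val : ℤ) - ((root x ν).val : ℤ)) := by
  classical
  have key : ∀ (n : ℕ) (x : Site P 0), (path x).length = n → ∃ r ∈ R,
      path x = walk r ((path x).map fun s => (s.bond.dir, s.fwd)) ∧ walkEnd r ((path x).map fun s => (s.bond.dir, s.fwd)) = x ∧
      ((∀ s ∈ path x, (s.bond.src s.bond.dir).val + 1 ≠ P.sitesPerDir 0) →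
        ∀ ν, netDisp ((path x).map fun s => (s.bond.dir, s.fwd)) ν = ((x ν).val : ℤ) - ((r ν).val : ℤ)) := by
    intro n
    induction' n using Nat.strong_induction_on with n ih
    intro x hn
    by_cases hxR : x ∈ R
    · refine ⟨x, hxR, ?_, ?_, fun _ ν => ?_⟩
      · rw [hroot x hxR]; rfl
      · rw [hroot x hxR]; rfl
      · rw [hroot x hxR]; simp [netDisp]
    · obtain ⟨x', s, hpx, hor⟩ := htree x hxR
      have hlt : (path x').length < n := by rw [← hn, hpx, List.length_append, List.length_singleton]; omega
      obtain ⟨r, hr, hwalk, hend, hdisp⟩ := ih _ hlt x' rfl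
      obtain ⟨hws, hwe⟩ := walk_singleton_of_step hor
      refine ⟨r, hr, ?_, ?_, fun hnw ν => ?_⟩
      · rw [hpx, List.map_append, List.map_singleton, walk_append, ← hwalk, hend, hws]
      · rw [hpx, List.map_append, List.map_singleton, walkEnd_append, hend, hwe]
      · have hnw' : ∀ t ∈ path x', (t.bond.src t.bond.dir).val + 1 ≠ P.sitesPerDir 0 := fun t ht => hnw t (by rw [hpx]; exact List.mem_append_left _ ht)
        have hs : (s.bond.src s.bond.dir).val + 1 ≠ P.sitesPerDir 0 := hnw s (by rw [hpx]; exact List.mem_append_right _ (List.mem_singleton_self s))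
        rw [hpx, List.map_append, List.map_singleton, T4ReflectionCone.netDisp_append, hdisp hnw' ν, netDisp_singleton]
        -- the last step: `x = x′ ± e_dir`, labels without wrap
        have hv := val_tgt_eq_of_not_wrap s.bond hs ν
        cases h : s.fwd
        · obtain ⟨hsrc, htgt⟩ := hor.2 h
          rw [hsrc, htgt] at hv
          by_cases hd : s.bond.dir = ν
          · rw [if_pos hd] at hv; simp only [hd, if_true, Bool.false_eq_true, if_false]; linarith
          · rw [if_neg hd] at hv; simp only [hd, if_false]; linarith
        · obtain ⟨hsrc, htgt⟩ := hor.1 h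
          rw [hsrc, htgt] at hv
          by_cases hd : s.bond.dir = ν
          · rw [if_pos hd] at hv; simp only [hd, if_true]; linarith
          · rw [if_neg hd] at hv; simp only [hd, if_false]; linarith
  choose root hrootR hroot' using fun x => key _ x rfl
  refine ⟨fun x => if x ∈ R then x else root x, fun r hr => if_pos hr, fun x => ?_⟩
  beta_reduce
  by_cases hxR : x ∈ R
  · rw [if_pos hxR]
    refine ⟨hxR, ?_, ?_, fun _ ν => ?_⟩
    · rw [hroot x hxR]; rfl
    · rw [hroot x hxR]; rfl
    · rw [hroot x hxR]; simp [netDisp]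
  · rw [if_neg hxR]
    exact ⟨hrootR x, hroot' x⟩

/-- **THE ROOT LIES IN EVERY BLOCK THAT CONFINES THE PATH**: if `path z = walk r (word z)` with `walkEnd r (word z) = z` and both ends of every step of `path z` lie in the `j`-block of `z`, then so
does `r` (it is `z` itself or an end of the first step). [cite: Balaban1987RG1, (0.1)–(0.3) pp.251–252 (bookkeeping)] -/
theorem iterBlockOf_root_eq_of_confined {path : Site P 0 → List (LStep P 0)} {r z : Site P 0} {j : ℕ}
    (hwalk : path z = walk r ((path z).map fun s => (s.bond.dir, s.fwd))) (hend : walkEnd r ((path z).map fun s => (s.bond.dir, s.fwd)) = z)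
    (hconf : ∀ s ∈ path z, iterBlockOf j s.bond.src = iterBlockOf j z ∧ iterBlockOf j s.bond.tgt = iterBlockOf j z) :
    iterBlockOf j r = iterBlockOf j z := by
  rcases hp : path z with _ | ⟨s₀, rest⟩
  · rw [hp] at hend
    exact congrArg _ hend
  · obtain ⟨hsrc, htgt⟩ := hconf s₀ (by rw [hp]; exact List.mem_cons_self)
    rw [hp, List.map_cons] at hwalk
    obtain ⟨⟨src, dir⟩, fwd⟩ := s₀
    cases fwd
    · -- backward first step: `s₀ = ⟨⟨r − e_dir, dir⟩, false⟩`, so `r = s₀.bond.tgt`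
      have h := List.head_eq_of_cons_eq hwalk
      simp only [LStep.mk.injEq, PBond.mk.injEq, and_true] at h
      have hr : r = (⟨src, dir⟩ : PBond P 0).tgt := by
        show r = src.shift dir
        rw [h]; exact (Site.shift_unshift r dir).symm
      rw [hr]; exact htgt
    · -- forward first step: `s₀ = ⟨⟨r, dir⟩, true⟩`, so `r = s₀.bond.src`
      have h := List.head_eq_of_cons_eq hwalk
      simp only [LStep.mk.injEq, PBond.mk.injEq, and_true] at h
      rw [← h]
      exact hsrc

end Words

/-! ## §2 The tower-confined forest with roots, words and true displacements -/

section Tower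

open Literature.MathematicalPhysics.QuantumFieldTheory.Balaban1983to89.B14.Eq213DetSet (Bj)
open Literature.MathematicalPhysics.QuantumFieldTheory.Balaban1983to89.B14.Eq213MaximalDomains (side)

/-- ★★★ **THE TOWER-CONFINED FOREST IN WORD CURRENCY** (dag-n12-w6's ASK-4): under (Cov) and `k ≤ m + K`, the forest of `N12TowerForest.exists_towerForest` together with its root map:
(F1), (F2), (TREE); `root x ∈ R(𝐁, k)`, `root r = r` on the roots, `path x = walk (root x) (word x)`, `walkEnd (root x) (word x) = x` (`word x` = the letters of `path x`); and for every root
level `j ≤ k` of `z` (`embIter j (iterBlockOf j z) ∈ R(𝐁, k)`): (TOWER) every step of `path z` has both ends in the `j`-block of `z`, (LEN) `|word z| = |path z| ≤ Σ_{i ≤ j}(d·(L^i − 1)∕2 + 1)`,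
(DISP) the TRUE integer displacement `netDisp (word z) ν = (z ν).val − (root z ν).val` (no step wraps: a unit step inside one block never crosses the seam), (ROOTBLK) `root z` lies in the
`j`-block of `z` (hence, in a block with no root other than its centre, `root z` IS the centre — `root_eq_centre_of_uniqueRoot`, dag-n12-w6's same-root clause).
[cite: Balaban1985RegularSpaces, (1.19) p.79; Balaban1985Variational, (4) p.278, (16)–(18) p.280; Balaban1988Convergent, (2.2) p.255, (2.13) pp.256–257; Balaban1987RG1, (0.1)–(0.3) pp.251–252] -/
theorem exists_towerForest_words (𝔹 : DetSet P) {k : ℕ} (hk : k ≤ P.m + P.K) (hcov : ∀ z : Site P 0, ∃ j, j ≤ k ∧ iterBlockOf j z ∈ 𝔹 j) :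
    ∃ (path : Site P 0 → List (LStep P 0)) (root : Site P 0 → Site P 0),
      (∀ x, ∀ s ∈ path x, ∃ x' x'' : Site P 0, path x'' = path x' ++ [s] ∧
        (s.fwd = true → s.bond.src = x' ∧ s.bond.tgt = x'') ∧ (s.fwd = false → s.bond.src = x'' ∧ s.bond.tgt = x')) ∧
      (∀ j, j ≤ k → ∀ c ∈ bondsOf (𝔹 j), path (embIter j c.src) = [] ∧ path (embIter j c.tgt) = []) ∧
      (∀ x : Site P 0, x ∉ {z : Site P 0 | ∃ j, j ≤ k ∧ ∃ c ∈ bondsOf (𝔹 j), (z = embIter j c.src ∨ z = embIter j c.tgt)} →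
        ∃ (x' : Site P 0) (s : LStep P 0), path x = path x' ++ [s] ∧
          (s.fwd = true → s.bond.src = x' ∧ s.bond.tgt = x) ∧ (s.fwd = false → s.bond.src = x ∧ s.bond.tgt = x')) ∧
      (∀ r ∈ {z : Site P 0 | ∃ j, j ≤ k ∧ ∃ c ∈ bondsOf (𝔹 j), (z = embIter j c.src ∨ z = embIter j c.tgt)}, root r = r) ∧
      (∀ x : Site P 0, root x ∈ {z : Site P 0 | ∃ j, j ≤ k ∧ ∃ c ∈ bondsOf (𝔹 j), (z = embIter j c.src ∨ z = embIter j c.tgt)} ∧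
        path x = walk (root x) ((path x).map fun s => (s.bond.dir, s.fwd)) ∧ walkEnd (root x) ((path x).map fun s => (s.bond.dir, s.fwd)) = x) ∧
      (∀ (z : Site P 0) (j : ℕ), j ≤ k →
        embIter j (iterBlockOf j z) ∈ {z : Site P 0 | ∃ j, j ≤ k ∧ ∃ c ∈ bondsOf (𝔹 j), (z = embIter j c.src ∨ z = embIter j c.tgt)} →
        (∀ s ∈ path z, iterBlockOf j s.bond.src = iterBlockOf j z ∧ iterBlockOf j s.bond.tgt = iterBlockOf j z) ∧
        (path z).length ≤ ∑ i ∈ Finset.range (j + 1), (P.d * ((P.L ^ i - 1) / 2) + 1) ∧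
        (∀ ν, netDisp ((path z).map fun s => (s.bond.dir, s.fwd)) ν = ((z ν).val : ℤ) - ((root z ν).val : ℤ)) ∧
        iterBlockOf j (root z) = iterBlockOf j z) := by
  obtain ⟨path, hF1, hF2, htree, htower, hlen⟩ := exists_towerForest 𝔹 hk hcov
  have hroot : ∀ r ∈ {z : Site P 0 | ∃ j, j ≤ k ∧ ∃ c ∈ bondsOf (𝔹 j), (z = embIter j c.src ∨ z = embIter j c.tgt)}, path r = [] := by
    rintro r ⟨j, hj, c, hc, rfl | rfl⟩
    · exact (hF2 j hj c hc).1
    · exact (hF2 j hj c hc).2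
  obtain ⟨root, hrootR, hw⟩ := exists_root_walk_word hroot htree
  refine ⟨path, root, hF1, hF2, htree, hrootR, fun x => ⟨(hw x).1, (hw x).2.1, (hw x).2.2.1⟩, fun z j hj hmem => ⟨htower z j hj hmem, hlen z j hj hmem, ?_,
    iterBlockOf_root_eq_of_confined (hw z).2.1 (hw z).2.2.1 (htower z j hj hmem)⟩⟩
  -- no step of `path z` wraps: both ends of every step lie in the `j`-block of `z`
  refine (hw z).2.2.2 fun s hs => ?_
  obtain ⟨hsrc, htgt⟩ := htower z j hj hmem s hs
  exact not_wrap_of_iterBlockOf_shift_eq (hj.trans hk) s.bond.src s.bond.dir (htgt.trans hsrc.symm)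

/-- ★★★ **THE TOWER-CONFINED FOREST IN WORD CURRENCY AT THE RECORD's `𝐁_k(Z)`, EVERY `Z`** ((Cov) by `N12FlatHndRecordLetters.hcov_Bj`): as `exists_towerForest_words`, with the member form of the
root levels (`iterBlockOf j z ∈ 𝐁_k(Z) j`) and, per site, a member level `j ≤ k` at which (TOWER), (LEN), (DISP) hold — dag-n12-w6's ASK-4 («the WORD `w x` with `path x = walk (root x) (w x)`,
its TRUE integer displacement, `|w x| ≤ ℓ_j`») BY NAME. [cite: Balaban1988Convergent, (2.2) p.255, (2.13) pp.256–257; Balaban1985RegularSpaces, (1.19) p.79; Balaban1987RG1, (0.1)–(0.3) pp.251–252] -/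
theorem exists_towerForest_words_Bj {k M₁ : ℕ} {Z : Set (Site P 0)} (hk : k ≤ P.m + P.K) (hk1 : 1 ≤ k) (hM : 1 ≤ M₁) (hdiv : side P.L M₁ k ∣ P.sitesPerDir 0) :
    ∃ (path : Site P 0 → List (LStep P 0)) (root : Site P 0 → Site P 0),
      (∀ x, ∀ s ∈ path x, ∃ x' x'' : Site P 0, path x'' = path x' ++ [s] ∧
        (s.fwd = true → s.bond.src = x' ∧ s.bond.tgt = x'') ∧ (s.fwd = false → s.bond.src = x'' ∧ s.bond.tgt = x')) ∧
      (∀ j, j ≤ k → ∀ c ∈ bondsOf ((Bj M₁ Z k : DetSet P) j), path (embIter j c.src) = [] ∧ path (embIter j c.tgt) = []) ∧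
      (∀ x : Site P 0, x ∉ {z : Site P 0 | ∃ j, j ≤ k ∧ ∃ c ∈ bondsOf ((Bj M₁ Z k : DetSet P) j), (z = embIter j c.src ∨ z = embIter j c.tgt)} →
        ∃ (x' : Site P 0) (s : LStep P 0), path x = path x' ++ [s] ∧
          (s.fwd = true → s.bond.src = x' ∧ s.bond.tgt = x) ∧ (s.fwd = false → s.bond.src = x ∧ s.bond.tgt = x')) ∧
      (∀ r ∈ {z : Site P 0 | ∃ j, j ≤ k ∧ ∃ c ∈ bondsOf ((Bj M₁ Z k : DetSet P) j), (z = embIter j c.src ∨ z = embIter j c.tgt)}, root r = r) ∧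
      (∀ x : Site P 0, root x ∈ {z : Site P 0 | ∃ j, j ≤ k ∧ ∃ c ∈ bondsOf ((Bj M₁ Z k : DetSet P) j), (z = embIter j c.src ∨ z = embIter j c.tgt)} ∧
        path x = walk (root x) ((path x).map fun s => (s.bond.dir, s.fwd)) ∧ walkEnd (root x) ((path x).map fun s => (s.bond.dir, s.fwd)) = x) ∧
      (∀ (z : Site P 0) (j : ℕ), j ≤ k → iterBlockOf j z ∈ (Bj M₁ Z k : DetSet P) j →
        (∀ s ∈ path z, iterBlockOf j s.bond.src = iterBlockOf j z ∧ iterBlockOf j s.bond.tgt = iterBlockOf j z) ∧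
        (path z).length ≤ ∑ i ∈ Finset.range (j + 1), (P.d * ((P.L ^ i - 1) / 2) + 1) ∧
        (∀ ν, netDisp ((path z).map fun s => (s.bond.dir, s.fwd)) ν = ((z ν).val : ℤ) - ((root z ν).val : ℤ)) ∧
        iterBlockOf j (root z) = iterBlockOf j z) ∧
      (∀ z : Site P 0, ∃ j, j ≤ k ∧ iterBlockOf j z ∈ (Bj M₁ Z k : DetSet P) j) := by
  have hcov := N12FlatHndRecordLetters.hcov_Bj hM hk1 hk hdiv (Z := Z)
  obtain ⟨path, root, h1, h2, h3, h4, h5, h6⟩ := exists_towerForest_words (Bj M₁ Z k) hk hcov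
  have hmem : ∀ (z : Site P 0) (j : ℕ), j ≤ k → iterBlockOf j z ∈ (Bj M₁ Z k : DetSet P) j →
      embIter j (iterBlockOf j z) ∈ {z : Site P 0 | ∃ j, j ≤ k ∧ ∃ c ∈ bondsOf ((Bj M₁ Z k : DetSet P) j), (z = embIter j c.src ∨ z = embIter j c.tgt)} :=
    fun z j hj hz => ⟨j, hj, ⟨iterBlockOf j z, ⟨0, P.hd⟩⟩, Or.inl hz, Or.inl rfl⟩
  exact ⟨path, root, h1, h2, h3, h4, h5, fun z j hj hz => h6 z j hj (hmem z j hj hz), hcov⟩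

/-- ★★ **SAME ROOT IN A SINGLY-ROOTED BLOCK** (the clause dag-n12-w6 asked for): for the tower forest in word currency, if the `j`-block of `z₁` equals that of `z₂`, its centre is a root level of both,
and the block contains NO root other than that centre, then `root z₁ = root z₂ =` the centre — so an in-block bond between them is a SAME-ROOT bond for `T4ForestGaugeSameRootBound`.
[cite: Balaban1985RegularSpaces, (1.19) p.79; Balaban1988Convergent, (2.2) p.255 (bookkeeping)] -/
theorem root_eq_centre_of_uniqueRoot {R : Set (Site P 0)} {root : Site P 0 → Site P 0} {j : ℕ} {z : Site P 0}
    (hrootR : root z ∈ R) (hblk : iterBlockOf j (root z) = iterBlockOf j z)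
    (huniq : ∀ r ∈ R, iterBlockOf j r = iterBlockOf j z → r = embIter j (iterBlockOf j z)) :
    root z = embIter j (iterBlockOf j z) :=
  huniq _ hrootR hblk

end Tower

end Summit.QuantumFields.YangMills.BalabanUVNodes.N12TowerForestWords

end
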